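import Mathlib
import Summits.Ventures.PercRepro.TriangleCapTwoTrianglesEightE

/-!
# PercRepro — TWO BELOW THE DIAGONAL IS EXACT ON THE `K₄⁻`-FREE CLASS FOR EVERY `k ≥ 12` (p3, gen 37; part 60)

The two-triangle case of the `r = 2` stability now holds for every `k ≥ 8` (vertex-disjoint triangles:
TriangleCapTwoTrianglesEightC; a shared vertex: TriangleCapTwoTrianglesEightE), so the assembly of gen 36
(`dense_stability_two_modulo_two_triangles`, whose other cases — triangle-free, one triangle, three triangles —
are theorems for `k ≥ 12`) closes for every `k ≥ 12`:

* **`two_triangles_stability_two_of_eight`** — the two-triangle case for every `k ≥ 8`;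
* **`dense_stability_two_of_twelve`** — `K₄⁻`-free, `k ≥ 12`, `m ≥ 2k − 3`, not bipartite spanning with at most one
  missing cross pair ⇒ `Σ_v d(v)² + 2 (k − 3) ≤ m k`;
* **`two_below_diagonal_exact_k4m_of_twelve`** — for `k ≥ 12` and `m = a(k − a) − 2 ≥ 2k − 3` with `m, m + 1` not
  of the form `a′(k − a′)`, the `K₄⁻`-free cherry maximum IS `(m(k − 2) − 2(k − 3))/2`, by `K_{a, k−a}` minus two
  edges at one vertex (gen 36 had `k ≥ 20`);
* the cells `(12, 25) = 116`, `(12, 30) = 141`, `(13, 28) = 144`, `(14, 31) = 175` (`2 · cherries`: `232`, `282`,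
  `288`, `350`).
Axioms: standard.
-/

namespace PercRepro

namespace TriangleCap

namespace C047

open Finset

variable {V : Type*} [Fintype V] [DecidableEq V]

/-- **THE TWO-TRIANGLE CASE OF THE `r = 2` STABILITY FOR EVERY `k ≥ 8`.** -/
theorem two_triangles_stability_two_of_eight (D : SimpleGraph V) [DecidableRel D.Adj] (hK : K4mFree D)
    (hk : 8 ≤ Fintype.card V) (hm : 2 * Fintype.card V ≤ D.edgeFinset.card + 3) {u v w a b c : V}
    (huv : D.Adj u v) (huw : D.Adj u w) (hvw : D.Adj v w) (hab : D.Adj a b) (hac : D.Adj a c) (hbc : D.Adj b c)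
    (ha : ¬ (a = u ∨ a = v ∨ a = w))
    (hT3 : ∀ x y z, D.Adj x y → D.Adj x z → D.Adj y z → x = u ∨ x = v ∨ x = w ∨ x = a ∨ x = b ∨ x = c) :
    ∑ v, deg D v * deg D v + 2 * (Fintype.card V - 3) ≤ D.edgeFinset.card * Fintype.card V := by
  by_cases hdisj : ∀ t, (t = u ∨ t = v ∨ t = w) → ¬ (t = a ∨ t = b ∨ t = c)
  · exact two_triangles_stability_two_of_disjoint_eight D hK hk huv huw hvw hab hac hbc hT3 hdisj
  · simp only [not_forall, not_not, exists_prop] at hdisj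
    obtain ⟨t, ht1, ht2⟩ := hdisj
    exact two_triangles_stability_two_of_shared_eight D hK hk hm huv huw hvw hab hac hbc ha hT3 ⟨ht1, ht2⟩

/-- **TWO BELOW THE DIAGONAL, `K₄⁻`-FREE, `k ≥ 12`:** the dense-corner stability with gap `2 (k − 3)`. -/
theorem dense_stability_two_of_twelve (D : SimpleGraph V) [DecidableRel D.Adj] (hK : K4mFree D)
    (hk : 12 ≤ Fintype.card V) (hm : 2 * Fintype.card V ≤ D.edgeFinset.card + 3)
    (hnot : ¬ ∃ A : Finset V, (∀ x y, D.Adj x y → (x ∈ A ↔ y ∉ A)) ∧ (missing D A Aᶜ).card ≤ 1) :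
    ∑ v, deg D v * deg D v + 2 * (Fintype.card V - 3) ≤ D.edgeFinset.card * Fintype.card V :=
  dense_stability_two_modulo_two_triangles D hK hk hm hnot
    (fun u v w a b c huv huw hvw hab hac hbc ha hT3 =>
      two_triangles_stability_two_of_eight D hK (by omega) hm huv huw hvw hab hac hbc ha hT3)

/-- **TWO BELOW THE DIAGONAL IS EXACT ON THE `K₄⁻`-FREE CLASS FOR EVERY `k ≥ 12`.** -/
theorem two_below_diagonal_exact_k4m_of_twelve (k a : ℕ) (hk : 12 ≤ k) (ha : 1 ≤ a) (hak : a + 2 ≤ k)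
    (hdense : 2 * k ≤ a * (k - a) - 2 + 3)
    (hm : ∀ a', a' ≤ k → a * (k - a) - 2 ≠ a' * (k - a') ∧ a * (k - a) - 1 ≠ a' * (k - a')) :
    (∀ (D : SimpleGraph (Fin k)) [DecidableRel D.Adj], K4mFree D →
        D.edgeFinset.card = a * (k - a) - 2 →
        2 * cherries D + 2 * (k - 3) ≤ (a * (k - a) - 2) * (k - 2)) ∧
      ∃ (D : SimpleGraph (Fin k)) (_ : DecidableRel D.Adj), K4mFree D ∧
        D.edgeFinset.card = a * (k - a) - 2 ∧ 2 * cherries D + 2 * (k - 3) = (a * (k - a) - 2) * (k - 2) := by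
  have hka : 2 ≤ a * (k - a) := by
    obtain ⟨c, hc⟩ : ∃ c, k = a + 2 + c := ⟨k - a - 2, by omega⟩
    subst hc
    have : a + 2 + c - a = 2 + c := by omega
    rw [this]
    nlinarith
  obtain ⟨m, hmm⟩ : ∃ m, a * (k - a) = m + 2 := ⟨a * (k - a) - 2, by omega⟩
  have e1 : a * (k - a) - 2 = m := by omega
  have e2 : a * (k - a) - 1 = m + 1 := by omega
  rw [e1] at hdense hm ⊢
  rw [e2] at hm
  constructor
  · intro D _ hK hD
    have hcard : Fintype.card (Fin k) = k := Fintype.card_fin k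
    have hnot : ¬ ∃ A : Finset (Fin k), (∀ x y, D.Adj x y → (x ∈ A ↔ y ∉ A)) ∧ (missing D A Aᶜ).card ≤ 1 := by
      rintro ⟨A, hA, hN⟩
      have hNX := card_missing_add_card_edges D A hA
      have hXc : Aᶜ.card = k - A.card := by
        have := card_add_card_compl A
        rw [hcard] at this
        omega
      have hXk : A.card ≤ k := by
        have := card_le_univ A
        rwa [hcard] at this
      obtain ⟨h1, h2⟩ := hm A.card hXk
      rw [hXc, hD] at hNX
      have : (missing D A Aᶜ).card = 0 ∨ (missing D A Aᶜ).card = 1 := by omega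
      rcases this with h | h
      · rw [h] at hNX; exact h1 (by omega)
      · rw [h] at hNX; exact h2 (by omega)
    have h1 := dense_stability_two_of_twelve D hK (by rw [hcard]; exact hk) (by rw [hcard, hD]; exact hdense) hnot
    have h2 := two_mul_cherries_add D
    have h3 := sum_deg_eq D
    rw [hcard, hD] at h1
    obtain ⟨k', hk'⟩ : ∃ k', k = k' + 3 := ⟨k - 3, by omega⟩
    subst hk'
    have e3 : k' + 3 - 3 = k' := by omega
    have e4 : k' + 3 - 2 = k' + 1 := by omega
    rw [e3] at h1 ⊢
    rw [e4]
    rw [hD] at h3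
    nlinarith
  · refine ⟨bipMinusStar k a 2, inferInstance, k4mFree_bipMinusStar k a 2, ?_, ?_⟩
    · have := card_edges_bipMinusStar k a 2 ha hak
      omega
    · have h := two_mul_cherries_bipMinusStar k a 2 ha hak (by omega)
      rw [hmm] at h
      obtain ⟨k', hk'⟩ : ∃ k', k = k' + 3 := ⟨k - 3, by omega⟩
      subst hk'
      have e3 : k' + 3 - 3 = k' := by omega
      have e4 : k' + 3 - 2 = k' + 1 := by omega
      have e5 : 2 * (k' + 3) - 2 - 3 = 2 * k' + 1 := by omega
      rw [e4, e5] at h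
      rw [e3, e4]
      nlinarith

/-- The cell `(12, 25)` on `K₄⁻`-free graphs (`25 = 3·9 − 2`; `25, 26` are not products `a′(12 − a′)`):
`2·cherries ≤ 232`, attained. -/
theorem cell_twelve_twentyfive_k4m :
    (∀ (D : SimpleGraph (Fin 12)) [DecidableRel D.Adj], K4mFree D → D.edgeFinset.card = 25 →
      2 * cherries D ≤ 232) ∧
    ∃ (D : SimpleGraph (Fin 12)) (_ : DecidableRel D.Adj), K4mFree D ∧ D.edgeFinset.card = 25 ∧
      2 * cherries D = 232 := by
  have h := two_below_diagonal_exact_k4m_of_twelve 12 3 (by norm_num) (by norm_num) (by norm_num) (by norm_num)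
    (by decide)
  have e1 : 3 * (12 - 3) - 2 = 25 := by norm_num
  have e2 : (3 * (12 - 3) - 2) * (12 - 2) = 250 := by norm_num
  have e3 : 2 * (12 - 3) = 18 := by norm_num
  rw [e1, e2, e3] at h
  obtain ⟨h1, D, inst, h2, h3, h4⟩ := h
  exact ⟨fun D _ hK hD => by have := h1 D hK hD; omega, D, inst, h2, h3, by omega⟩

/-- The cell `(12, 30)` on `K₄⁻`-free graphs (`30 = 4·8 − 2`; `30, 31` are not products `a′(12 − a′)`):
`2·cherries ≤ 282`, attained. -/
theorem cell_twelve_thirty_k4m :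
    (∀ (D : SimpleGraph (Fin 12)) [DecidableRel D.Adj], K4mFree D → D.edgeFinset.card = 30 →
      2 * cherries D ≤ 282) ∧
    ∃ (D : SimpleGraph (Fin 12)) (_ : DecidableRel D.Adj), K4mFree D ∧ D.edgeFinset.card = 30 ∧
      2 * cherries D = 282 := by
  have h := two_below_diagonal_exact_k4m_of_twelve 12 4 (by norm_num) (by norm_num) (by norm_num) (by norm_num)
    (by decide)
  have e1 : 4 * (12 - 4) - 2 = 30 := by norm_num
  have e2 : (4 * (12 - 4) - 2) * (12 - 2) = 300 := by norm_num
  have e3 : 2 * (12 - 3) = 18 := by norm_num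
  rw [e1, e2, e3] at h
  obtain ⟨h1, D, inst, h2, h3, h4⟩ := h
  exact ⟨fun D _ hK hD => by have := h1 D hK hD; omega, D, inst, h2, h3, by omega⟩

/-- The cell `(13, 28)` on `K₄⁻`-free graphs (`28 = 3·10 − 2`; `28, 29` are not products `a′(13 − a′)`):
`2·cherries ≤ 288`, attained. -/
theorem cell_thirteen_twentyeight_k4m :
    (∀ (D : SimpleGraph (Fin 13)) [DecidableRel D.Adj], K4mFree D → D.edgeFinset.card = 28 →
      2 * cherries D ≤ 288) ∧
    ∃ (D : SimpleGraph (Fin 13)) (_ : DecidableRel D.Adj), K4mFree D ∧ D.edgeFinset.card = 28 ∧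
      2 * cherries D = 288 := by
  have h := two_below_diagonal_exact_k4m_of_twelve 13 3 (by norm_num) (by norm_num) (by norm_num) (by norm_num)
    (by decide)
  have e1 : 3 * (13 - 3) - 2 = 28 := by norm_num
  have e2 : (3 * (13 - 3) - 2) * (13 - 2) = 308 := by norm_num
  have e3 : 2 * (13 - 3) = 20 := by norm_num
  rw [e1, e2, e3] at h
  obtain ⟨h1, D, inst, h2, h3, h4⟩ := h
  exact ⟨fun D _ hK hD => by have := h1 D hK hD; omega, D, inst, h2, h3, by omega⟩

/-- The cell `(14, 31)` on `K₄⁻`-free graphs (`31 = 3·11 − 2`; `31, 32` are not products `a′(14 − a′)`):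
`2·cherries ≤ 350`, attained. -/
theorem cell_fourteen_thirtyone_k4m :
    (∀ (D : SimpleGraph (Fin 14)) [DecidableRel D.Adj], K4mFree D → D.edgeFinset.card = 31 →
      2 * cherries D ≤ 350) ∧
    ∃ (D : SimpleGraph (Fin 14)) (_ : DecidableRel D.Adj), K4mFree D ∧ D.edgeFinset.card = 31 ∧
      2 * cherries D = 350 := by
  have h := two_below_diagonal_exact_k4m_of_twelve 14 3 (by norm_num) (by norm_num) (by norm_num) (by norm_num)
    (by decide)
  have e1 : 3 * (14 - 3) - 2 = 31 := by norm_num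
  have e2 : (3 * (14 - 3) - 2) * (14 - 2) = 372 := by norm_num
  have e3 : 2 * (14 - 3) = 22 := by norm_num
  rw [e1, e2, e3] at h
  obtain ⟨h1, D, inst, h2, h3, h4⟩ := h
  exact ⟨fun D _ hK hD => by have := h1 D hK hD; omega, D, inst, h2, h3, by omega⟩

end C047

end TriangleCap

end PercRepro
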